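import Summits.RiemannHypothesis.RiemannHypothesis.Theorems.GroundBartaEvenWinsBeyondArchDeflationM80FAssemblyE3
import Summits.RiemannHypothesis.RiemannHypothesis.Theorems.GroundBartaEvenWinsBeyondArchDeflationCertBridgeSigma
import Summits.RiemannHypothesis.RiemannHypothesis.Theorems.GroundBartaEvenWinsBeyondArchDeflationPSDFromBounds
import Summits.RiemannHypothesis.RiemannHypothesis.Theorems.WeilGroundStateGroundStateSimpleEvenTrialUpperFConst
import Summits.RiemannHypothesis.RiemannHypothesis.Theorems.WeilTwoPrimeDeflM80FCert
import Literature.NumberTheory.LFunctions.WeilDeflationPenaltyPolyEval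
import Summits.RiemannHypothesis.RiemannHypothesis.Theorems.GroundBartaEvenWinsBeyondArchDeflationM72Final
import Summits.RiemannHypothesis.RiemannHypothesis.Theorems.GroundBartaEvenWinsBeyondArchDeflationM80FAssemblyT3
import Summits.RiemannHypothesis.RiemannHypothesis.Theorems.GroundBartaEvenWinsBeyondArchDeflationPSDFromBoundsM
import Summits.RiemannHypothesis.RiemannHypothesis.Theorems.GroundBartaEvenWinsBeyondArchDeflationMarkovY2
import Summits.RiemannHypothesis.RiemannHypothesis.Theorems.GroundBartaEvenWinsBeyondArchDeflationCrossGram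
import Summits.RiemannHypothesis.RiemannHypothesis.Theorems.GroundBartaEvenWinsBeyondArchDeflationCertBridgeW
import HarnessLib

/-!
# RiemannHypothesis / GroundBarta — rung 4 (`EvenWinsBeyondArch`, stmt-RiemannHypothesis-18807 / 18085):
# the deflated Temple L-side at `c = 4023/5000` (last three-prime cell, `N = 271` certificate) — window image and the final inequalities modulo R-layer data

Helper file (`--supports stmt-RiemannHypothesis-18085`), RH-free.  Prover A, speedrun unit `sr-gb-rung-a` (gens 2/4/5 generators
`cert/abgen/gen_final.py`, `gen_finalT.py`, FinalGW template; merged into one module by gen 7 to save two build-lane cycles).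

* `m80FF` — the window image of the six trial vectors `m80Fv i = 𝟙·P_i(x/b)` (`m80F_mask` identifies them with the certificate's penalties);
* `dt_m80F_oddLower_of_sigma` — `λ ≤ ε_od(4023/5000)` from the certificate `deflBound_weilCertDeflM80F` (`β₂₃ = 17/25`, `a₀ = 4023/5000`),
  the A-layer (`m80F_A_mem`, `m80F_inner`) and prover B's sigma data + a kernel PSD certificate;
* `dt_m80F_oddLower_of_sigmaT` — the same against the MARKOV-FREE entry bounds `m80FTAlo/hi` with the certified `M ≤ m80FMhi` (`dt_hN_of_boundsT`);
* `dt_m80F_oddLower_of_gramW` — the WEIGHTED cross-Gram form (edge-only three-prime sliver, …CertBridgeW): prover B supplies weighted residual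
  norms `∫ w‖r_i‖² ≤ sW_i` and boxes for `∫ w Re(r_i r̄_j)` (`w = wE` on `|y| ≥ y₁`, `wI` inside; `wI = 1/(17/25 − λ)`, `wE = 1/(17/25 − κ₂ − λ)`,
  `κ₂ ≥ (log 2)/2`, `y₁ ≤ log 4 − 4023/5000`), kernel certificate for `A − λG − R_w`.
-/

set_option linter.dupNamespace false

noncomputable section

open MeasureTheory Set
open scoped BigOperators ComplexConjugate

namespace Summit.RiemannHypothesis.RiemannHypothesis.Theorems.EvenWinsBeyondArch


open Literature.NumberTheory.LFunctions Literature.Analysis.ValidatedNumerics.ExpPoly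
open Literature.Analysis.ValidatedNumerics.PolyMP Summit.RiemannHypothesis.RiemannHypothesis.Theorems.EvenWinsBeyondArch.ArchM80F
open Summit.RiemannHypothesis.RiemannHypothesis.Theorems.OddSector (weilDirichletEnergy₂ weilPoleForm₂)
open Summit.RiemannHypothesis.RiemannHypothesis.Theorems.GroundStateSimpleEven (tuf_log_two_bounds)

open Literature.Analysis.ValidatedNumerics.PolyMP

/-- The penalty list of certificate M80F has six entries. [folklore] -/
theorem m80F_Rlen : weilCertDeflM80FR.length = 6 := rfl

set_option maxHeartbeats 0 in
/-- The certificate's masked coefficient vectors are the trimmed data polynomials `P_i` padded with zeros. [folklore] -/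
theorem m80F_trim : ∀ i : Fin 6, (List.range 272).map (maskV (weilCertDeflM80FR.get (Fin.cast m80F_Rlen.symm i))) =
    m80FP i ++ List.replicate (272 - (m80FP i).length) 0 := by
  decide +kernel

/-- Odd parities and non-negative weights of the penalties. [folklore] -/
theorem m80F_Rodd : (∀ i : Fin weilCertDeflM80FR.length, (weilCertDeflM80FR.get i).2.1 % 2 = 1) ∧
    (∀ i : Fin weilCertDeflM80FR.length, 0 ≤ (weilCertDeflM80FR.get i).1) := by
  constructor <;> decide

/-- **The bridge's trial vectors are the A-layer vectors**: `𝟙_{[-c,c]}·maskPoly(r_i, 272, 18/25) = m80Fv i`. [folklore] -/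
theorem m80F_mask (i : Fin 6) (x : ℝ) :
    (((Icc (-(4023 / 5000 : ℝ)) (4023 / 5000)).indicator (fun x ↦ maskPoly (weilCertDeflM80FR.get (Fin.cast m80F_Rlen.symm i)) 272 (4023 / 5000) x) x
        : ℝ) : ℂ) = m80Fv i x := by
  unfold m80Fv
  rw [dt_wY_apply]
  push_cast
  congr 1
  by_cases hx : x ∈ Icc (-(4023 / 5000 : ℝ)) (4023 / 5000)
  · rw [indicator_of_mem hx, indicator_of_mem (by simpa using hx), maskPoly_eq_poly_eval_of_trim _ _ (m80F_trim i)]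
  · rw [indicator_of_notMem hx, indicator_of_notMem (by simpa using hx)]

/-- The window image of `v_i` at `c = 4023/5000` (the bridge's `F_i`, stated for `m80Fv`). [folklore] -/
def m80FF (i : Fin 6) (y : ℝ) : ℂ :=
  (Icc (-(4023 / 5000 : ℝ)) (4023 / 5000)).indicator (fun y ↦
      2 * (∫ x, m80Fv i x * (Real.cosh (x / 2) : ℂ)) * (Real.cosh (y / 2) : ℂ) -
        2 * (∫ x, m80Fv i x * (Real.sinh (x / 2) : ℂ)) * (Real.sinh (y / 2) : ℂ) +
      (∑ m ∈ weilPrimeIndex (4023 / 5000 : ℝ), (((ArithmeticFunction.vonMangoldt m : ℝ) / Real.sqrt m : ℝ) : ℂ) *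
        (2 * m80Fv i y - m80Fv i (y - Real.log m) - m80Fv i (y + Real.log m))) +
      ∫ t in Ioi 0, (weilArchDensity t : ℂ) * (2 * m80Fv i y - m80Fv i (y - t) - m80Fv i (y + t))) y -
    (weilMarkovConstant (4023 / 5000 : ℝ) : ℂ) * m80Fv i y

/-- **`λ ≤ ε_od(4023/5000)` modulo the sigma data.**  Prover B supplies `W`, `s`, `θ` (positive), the residual bounds `hs`
for `m80Fv` / `m80FF`, the budget `Σ s_i/θ_i ≤ τ`; the kernel PSD certificate (`nCheck₂` + scaled LDL data) is generated by
`cert/abgen/psdcert.py`. [cite: GoerischHaunhorst1985, §2] -/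
theorem dt_m80F_oddLower_of_sigma (W : Fin 6 → Fin 6 → ℝ) (s : Fin 6 → ℝ) (θq : Fin 6 → ℚ) (hθ : ∀ i, 0 < θq i)
    (hs : ∀ i, ∫ x, ‖(m80FF i - ∑ l, W i l • m80Fv l) x‖ ^ 2 ≤ s i) (τ : ℚ) (hτ : ∑ i, s i / (θq i : ℝ) ≤ (τ : ℝ))
    (lam : ℚ) (hlam : lam < m72βlo) {m : ℕ} (sc : Fin 6 → ℚ) (P E : Fin 6 → Fin 6 → ℚ) (D : Fin m → ℚ)
    (L : Fin m → Fin 6 → ℚ) (δ : ℚ) (hchk : nCheck₂ m72βlo m72βhi lam τ θq sc m80FAlo m80FAhi m80FG P E = true)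
    (hrow : ∀ i, ∑ j, E i j ≤ δ) (hcol : ∀ j, ∑ i, E i j ≤ δ) (hD : ∀ r, 0 ≤ D r)
    (hP : ∀ i j, P i j = δ * (if i = j then 1 else 0) + ∑ r, D r * L r i * L r j) :
    (lam : ℝ) ≤ weilOddGroundEnergy (4023 / 5000 : ℝ) := by
  have hc : (0 : ℝ) < 4023 / 5000 := by norm_num
  have hc5 : (4023 / 5000 : ℝ) ≤ Real.log 5 / 2 := by have := m80_le_log5; push_cast at this; linarith
  have hβ := m72_beta_mem
  have hlamR : (lam : ℝ) < 17 / 25 - Real.log 2 / 2 := by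
    have : ((lam : ℚ) : ℝ) < ((m72βlo : ℚ) : ℝ) := by exact_mod_cast hlam
    linarith [hβ.1]
  -- the certificate conclusion in the bridge's form
  have hcert := fun (g : ℝ → ℂ) (hg : IsWeilTest g) (hsupp : tsupport g ⊆ Icc (-(4023 / 5000 : ℝ)) (4023 / 5000))
      (hodd : ∀ x, g (-x) = -g x) ↦ deflBound_weilCertDeflM80F hg hsupp hodd
  obtain ⟨hN1, ha0⟩ := params_weilCertDeflM80F
  have hβ23 : ((weilCertDeflM80FBeta : ℚ) : ℝ) = 17 / 25 := by show (((17 / 25 : ℚ)) : ℝ) = _; norm_num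
  simp only [hN1, ha0, hβ23] at hcert
  -- the A-layer hN
  have hA := m80F_A_mem
  have hG := m80F_inner
  have hN := dt_hN_of_bounds₂
    (fun i j ↦ weilPoleForm₂ (m80Fv i) (m80Fv j) + weilDirichletEnergy₂ (((4023 / 5000 : ℚ)) : ℝ) (m80Fv i) (m80Fv j) -
      weilMarkovConstant (((4023 / 5000 : ℚ)) : ℝ) * ∫ x, (m80Fv i x * conj (m80Fv j x)).re)
    m80FAlo m80FAhi m80FG hA (fun i j ↦ ∫ x, (m80Fv i x * conj (m80Fv j x)).re) hG m72βlo m72βhi hβ lam τ θq sc P E D L δ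
    hchk hrow hcol hD hP
  have h1825 : (((4023 / 5000 : ℚ)) : ℝ) = (4023 / 5000 : ℝ) := by norm_num
  simp only [h1825] at hN
  exact dt_weilOddGroundEnergy_ge_of_deflCert_sigma hc hc5 le_rfl weilCertDeflM80FR 272 m80F_Rodd.1 m80F_Rodd.2 hcert
    m80Fv m80FF (fun i x ↦ (m80F_mask i x).symm) (fun i y ↦ rfl) W hlamR s (fun i ↦ (θq i : ℝ))
    (fun i ↦ by exact_mod_cast hθ i) hs hτ hN

/-- The certified upper bound of the killing constant used in the certificate. [folklore] -/
def m80FMhi : ℚ := 83141569444492860400 / 10000000000000000000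

/-- **`λ ≤ ε_od(4023/5000)` modulo the sigma data, Markov-free certificate.** [folklore] -/
theorem dt_m80F_oddLower_of_sigmaT (W : Fin 6 → Fin 6 → ℝ) (s : Fin 6 → ℝ) (θq : Fin 6 → ℚ) (hθ : ∀ i, 0 < θq i)
    (hs : ∀ i, ∫ x, ‖(m80FF i - ∑ l, W i l • m80Fv l) x‖ ^ 2 ≤ s i) (τ : ℚ) (hτ : ∑ i, s i / (θq i : ℝ) ≤ (τ : ℝ))
    (lam : ℚ) (hlam : lam < m72βlo) {m : ℕ} (sc : Fin 6 → ℚ) (P E : Fin 6 → Fin 6 → ℚ) (D : Fin m → ℚ)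
    (L : Fin m → Fin 6 → ℚ) (δ : ℚ)
    (hchk : nCheck₂ m72βlo m72βhi lam τ θq sc (fun i j ↦ m80FTAlo i j - m80FMhi * m80FG i j)
      (fun i j ↦ m80FTAhi i j - m80FMhi * m80FG i j) m80FG P E = true)
    (hrow : ∀ i, ∑ j, E i j ≤ δ) (hcol : ∀ j, ∑ i, E i j ≤ δ) (hD : ∀ r, 0 ≤ D r)
    (hP : ∀ i j, P i j = δ * (if i = j then 1 else 0) + ∑ r, D r * L r i * L r j) :
    (lam : ℝ) ≤ weilOddGroundEnergy (4023 / 5000 : ℝ) := by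
  have hc : (0 : ℝ) < 4023 / 5000 := by norm_num
  have hc5 : (4023 / 5000 : ℝ) ≤ Real.log 5 / 2 := by have := m80_le_log5; push_cast at this; linarith
  have hβ := m72_beta_mem
  have hlamR : (lam : ℝ) < 17 / 25 - Real.log 2 / 2 := by
    have : ((lam : ℚ) : ℝ) < ((m72βlo : ℚ) : ℝ) := by exact_mod_cast hlam
    linarith [hβ.1]
  have hcert := fun (g : ℝ → ℂ) (hg : IsWeilTest g) (hsupp : tsupport g ⊆ Icc (-(4023 / 5000 : ℝ)) (4023 / 5000))
      (hodd : ∀ x, g (-x) = -g x) ↦ deflBound_weilCertDeflM80F hg hsupp hodd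
  obtain ⟨hN1, ha0⟩ := params_weilCertDeflM80F
  have hβ23 : ((weilCertDeflM80FBeta : ℚ) : ℝ) = 17 / 25 := by show (((17 / 25 : ℚ)) : ℝ) = _; norm_num
  simp only [hN1, ha0, hβ23] at hcert
  have hM : weilMarkovConstant (4023 / 5000 : ℝ) ≤ ((m80FMhi : ℚ) : ℝ) := by
    have h2 := m80_log2_lt; have h5 := m80_le_log5; push_cast at h2 h5
    have := (dt_weilMarkovConstant_sharp h2 h5).2; unfold m80FMhi; push_cast at this ⊢; exact this
  have hA := m80F_TA_mem
  have hG := m80F_inner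
  have hN := dt_hN_of_boundsT
    (fun i j ↦ weilPoleForm₂ (m80Fv i) (m80Fv j) + weilDirichletEnergy₂ (((4023 / 5000 : ℚ)) : ℝ) (m80Fv i) (m80Fv j))
    m80FTAlo m80FTAhi m80FG hA (fun i j ↦ ∫ x, (m80Fv i x * conj (m80Fv j x)).re) hG
    (M := weilMarkovConstant (4023 / 5000 : ℝ)) m80FMhi hM m80FGD m80FGL m80F_G_ldl.1 m80F_G_ldl.2
    m72βlo m72βhi hβ lam τ θq sc P E D L δ hchk hrow hcol hD hP
  have h1825 : (((4023 / 5000 : ℚ)) : ℝ) = (4023 / 5000 : ℝ) := by norm_num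
  simp only [h1825] at hN
  exact dt_weilOddGroundEnergy_ge_of_deflCert_sigma hc hc5 le_rfl weilCertDeflM80FR 272 m80F_Rodd.1 m80F_Rodd.2 hcert
    m80Fv m80FF (fun i x ↦ (m80F_mask i x).symm) (fun i y ↦ rfl) W hlamR s (fun i ↦ (θq i : ℝ))
    (fun i ↦ by exact_mod_cast hθ i) hs hτ hN

/-- **`λ ≤ ε_od(4023/5000)` modulo WEIGHTED R-layer data** (edge-only sliver).  `W` is prover B's coefficient matrix; `wI, wE` the two
weight values (`wI = 1/(17/25 − λ)`, `wE = 1/(17/25 − κ₂ − λ)`, `κ₂ ≥ (log 2)/2`), `y₁ ≤ log 4 − 4023/5000` the edge threshold; `sW_i` bounds for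
`∫ w‖r_i‖²`, `[Rlo_ij, Rhi_ij]` (`i ≠ j`) boxes for `∫ w Re(r_i r̄_j)` (diagonal boxes `[sW_i, sW_i]`); `sc, P, E, D, L, δ` the scaled kernel
certificate of `A − λG − R_w` (`nEntry` at `β' = λ + 1`). [folklore] -/
theorem dt_m80F_oddLower_of_gramW (W : Fin 6 → Fin 6 → ℝ) (lam κ₂ wI wE y₁ : ℚ) (hκ : Real.log 2 / 2 ≤ (κ₂ : ℝ))
    (hlam : lam + κ₂ < 17 / 25) (hwI : wI = 1 / (17 / 25 - lam)) (hwE : wE = 1 / (17 / 25 - κ₂ - lam))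
    (hy : (y₁ : ℝ) ≤ Real.log 4 - 4023 / 5000) (sW : Fin 6 → ℚ)
    (hsW : ∀ i, ∫ y, {u : ℝ | (y₁ : ℝ) ≤ |u|}.piecewise (fun _ ↦ (wE : ℝ)) (fun _ ↦ (wI : ℝ)) y *
      ‖(m80FF i - ∑ l, W i l • m80Fv l) y‖ ^ 2 ≤ (sW i : ℝ))
    (Rlo Rhi : Fin 6 → Fin 6 → ℚ) (hRdiag : ∀ i, Rlo i i = sW i ∧ Rhi i i = sW i)
    (hR : ∀ i j, i ≠ j →
      (Rlo i j : ℝ) ≤ ∫ y, {u : ℝ | (y₁ : ℝ) ≤ |u|}.piecewise (fun _ ↦ (wE : ℝ)) (fun _ ↦ (wI : ℝ)) y *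
          ((m80FF i - ∑ l, W i l • m80Fv l) y * conj ((m80FF j - ∑ l, W j l • m80Fv l) y)).re ∧
        ∫ y, {u : ℝ | (y₁ : ℝ) ≤ |u|}.piecewise (fun _ ↦ (wE : ℝ)) (fun _ ↦ (wI : ℝ)) y *
          ((m80FF i - ∑ l, W i l • m80Fv l) y * conj ((m80FF j - ∑ l, W j l • m80Fv l) y)).re ≤ (Rhi i j : ℝ))
    {m : ℕ} (sc : Fin 6 → ℚ) (hsc : ∀ i, 0 < sc i) (P E : Fin 6 → Fin 6 → ℚ)
    (D : Fin m → ℚ) (L : Fin m → Fin 6 → ℚ) (δ : ℚ)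
    (hPE : ∀ i j, ∀ a ∈ [m80FTAlo i j - m80FMhi * m80FG i j, m80FTAhi i j - m80FMhi * m80FG i j],
      P i j - E i j ≤ sc i * sc j * nEntry (lam + 1) lam (m80FG i j) (Rhi i j) a ∧
        sc i * sc j * nEntry (lam + 1) lam (m80FG i j) (Rlo i j) a ≤ P i j + E i j)
    (hrow : ∀ i, ∑ j, E i j ≤ δ) (hcol : ∀ j, ∑ i, E i j ≤ δ) (hD : ∀ r, 0 ≤ D r)
    (hP : ∀ i j, P i j = δ * (if i = j then 1 else 0) + ∑ r, D r * L r i * L r j) :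
    (lam : ℝ) ≤ weilOddGroundEnergy (4023 / 5000 : ℝ) := by
  classical
  have hc : (0 : ℝ) < 4023 / 5000 := by norm_num
  have hc5 : (4023 / 5000 : ℝ) ≤ Real.log 5 / 2 := by have := m80_le_log5; push_cast at this; linarith
  have hlamQ : ((lam : ℚ) : ℝ) + (κ₂ : ℝ) < 17 / 25 := by
    have h := (Rat.cast_lt (K := ℝ)).2 hlam; push_cast at h; exact h
  have hlamR : (lam : ℝ) < 17 / 25 - (κ₂ : ℝ) := by linarith
  have hlog0 : 0 < Real.log 2 / 2 := by positivity
  have hnI : (0 : ℝ) < 17 / 25 - lam := by linarith [hlog0.le.trans hκ]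
  have hnE : (0 : ℝ) < 17 / 25 - κ₂ - lam := by linarith
  have hwIR : (wI : ℝ) = 1 / (17 / 25 - (lam : ℝ)) := by rw [hwI]; push_cast; ring
  have hwER : (wE : ℝ) = 1 / (17 / 25 - (κ₂ : ℝ) - (lam : ℝ)) := by rw [hwE]; push_cast; ring
  have hcert := fun (g : ℝ → ℂ) (hg : IsWeilTest g) (hsupp : tsupport g ⊆ Icc (-(4023 / 5000 : ℝ)) (4023 / 5000))
      (hodd : ∀ x, g (-x) = -g x) ↦ deflBound_weilCertDeflM80F hg hsupp hodd
  obtain ⟨hN1, ha0⟩ := params_weilCertDeflM80F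
  have hβ23 : ((weilCertDeflM80FBeta : ℚ) : ℝ) = 17 / 25 := by show (((17 / 25 : ℚ)) : ℝ) = _; norm_num
  simp only [hN1, ha0, hβ23] at hcert
  have hM : weilMarkovConstant (4023 / 5000 : ℝ) ≤ ((m80FMhi : ℚ) : ℝ) := by
    have h2 := m80_log2_lt; have h5 := m80_le_log5; push_cast at h2 h5
    have := (dt_weilMarkovConstant_sharp h2 h5).2; unfold m80FMhi; push_cast at this ⊢; exact this
  have hA := m80F_TA_mem
  have hG := m80F_inner
  -- the weight, the residuals and their weighted copies `r̃_i = √w · r_i`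
  set Ew : Set ℝ := {u : ℝ | (y₁ : ℝ) ≤ |u|} with hEw
  set w : ℝ → ℝ := Ew.piecewise (fun _ ↦ (wE : ℝ)) (fun _ ↦ (wI : ℝ)) with hwdef
  have hw0 : ∀ y, 0 ≤ w y := by
    intro y
    by_cases hy' : y ∈ Ew
    · rw [hwdef, Set.piecewise_eq_of_mem _ _ _ hy', hwER]; positivity
    · rw [hwdef, Set.piecewise_eq_of_notMem _ _ _ hy', hwIR]; positivity
  set r : Fin 6 → ℝ → ℂ := fun i ↦ m80FF i - ∑ l, W i l • m80Fv l with hr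
  set rt : Fin 6 → ℝ → ℂ := fun i y ↦ ((Real.sqrt (w y) : ℝ) : ℂ) * r i y with hrt
  have hrt_sq : ∀ i, ∫ y, ‖rt i y‖ ^ 2 = ∫ y, w y * ‖r i y‖ ^ 2 := fun i ↦
    integral_congr_ae (Filter.Eventually.of_forall fun y ↦ dt_norm_sq_sqrt_mul (hw0 y) _)
  have hrt_cross : ∀ i j, ∫ y, (rt i y * conj (rt j y)).re = ∫ y, w y * (r i y * conj (r j y)).re := fun i j ↦
    integral_congr_ae (Filter.Eventually.of_forall fun y ↦ dt_sqrt_mul_pairing_pt hw0 (r i) (r j) y)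
  -- the matrix `R'_w` (certified diagonal bounds, true weighted cross terms) and its boxes
  set Rm : Fin 6 → Fin 6 → ℝ := fun i j ↦ if i = j then ((sW i : ℚ) : ℝ) else ∫ y, (rt i y * conj (rt j y)).re with hRm
  have hRbox : ∀ i j, (Rlo i j : ℝ) ≤ Rm i j ∧ Rm i j ≤ (Rhi i j : ℝ) := by
    intro i j
    by_cases hij : i = j
    · subst hij
      obtain ⟨h1, h2⟩ := hRdiag i
      simp only [hRm, if_true, h1, h2]; exact ⟨le_rfl, le_rfl⟩
    · simp only [hRm, if_neg hij, hrt_cross, hr, hwdef, hEw]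
      exact hR i j hij
  -- kernel certificate ⇒ `(A − λG) − R'_w ⪰ 0` (β' = λ + 1)
  have hPE' : ∀ i j, ∀ β' ∈ [lam + 1, lam + 1], ∀ a ∈ [m80FTAlo i j - m80FMhi * m80FG i j, m80FTAhi i j - m80FMhi * m80FG i j],
      P i j - E i j ≤ sc i * sc j * nEntry β' lam (m80FG i j) (Rhi i j) a ∧
        sc i * sc j * nEntry β' lam (m80FG i j) (Rlo i j) a ≤ P i j + E i j := by
    intro i j β' hβ' a ha
    have : β' = lam + 1 := by simpa using hβ'
    subst this
    exact hPE i j a ha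
  have hN := dt_hN_of_boundsT₃
    (fun i j ↦ weilPoleForm₂ (m80Fv i) (m80Fv j) + weilDirichletEnergy₂ (((4023 / 5000 : ℚ)) : ℝ) (m80Fv i) (m80Fv j))
    m80FTAlo m80FTAhi m80FG hA (fun i j ↦ ∫ x, (m80Fv i x * conj (m80Fv j x)).re) hG
    (M := weilMarkovConstant (4023 / 5000 : ℝ)) m80FMhi hM m80FGD m80FGL m80F_G_ldl.1 m80F_G_ldl.2
    (β := (lam : ℝ) + 1) (lam + 1) (lam + 1) (by push_cast; exact ⟨le_rfl, le_rfl⟩) Rm Rlo Rhi hRbox lam (by linarith)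
    sc hsc P E D L δ hPE' hrow hcol hD hP
  have h1825 : (((4023 / 5000 : ℚ)) : ℝ) = (4023 / 5000 : ℝ) := by norm_num
  simp only [h1825, add_sub_cancel_left, one_mul] at hN
  -- cross-Gram criterion on the weighted residuals ⇒ the bridge's weighted `hPSD`
  have hsR : ∀ i, ∫ y, ‖rt i y‖ ^ 2 ≤ ((sW i : ℚ) : ℝ) := fun i ↦ by
    rw [hrt_sq]; simpa only [hr, hwdef, hEw] using hsW i
  have hPSD := dt_psd_of_crossGram
    (fun i j ↦ (weilPoleForm₂ (m80Fv i) (m80Fv j) + weilDirichletEnergy₂ (4023 / 5000 : ℝ) (m80Fv i) (m80Fv j) -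
          weilMarkovConstant (4023 / 5000 : ℝ) * ∫ x, (m80Fv i x * conj (m80Fv j x)).re) -
        (lam : ℝ) * ∫ x, (m80Fv i x * conj (m80Fv j x)).re)
    rt (fun i ↦ ((sW i : ℚ) : ℝ)) hsR (fun α ↦ by simpa only [hRm] using hN α)
  -- the weight in the bridge's form
  have hwform : ∀ y, w y = Ew.piecewise (fun _ ↦ 1 / (17 / 25 - (κ₂ : ℝ) - (lam : ℝ))) (fun _ ↦ 1 / (17 / 25 - (lam : ℝ))) y := by
    intro y
    by_cases hy' : y ∈ Ew
    · rw [hwdef, Set.piecewise_eq_of_mem _ _ _ hy', Set.piecewise_eq_of_mem _ _ _ hy', hwER]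
    · rw [hwdef, Set.piecewise_eq_of_notMem _ _ _ hy', Set.piecewise_eq_of_notMem _ _ _ hy', hwIR]
  have hPSD' : ∀ α : Fin 6 → ℝ, 0 ≤ ∑ i, ∑ j, α i * α j *
      ((weilPoleForm₂ (m80Fv i) (m80Fv j) + weilDirichletEnergy₂ (4023 / 5000 : ℝ) (m80Fv i) (m80Fv j) -
          weilMarkovConstant (4023 / 5000 : ℝ) * ∫ x, (m80Fv i x * conj (m80Fv j x)).re) -
        (lam : ℝ) * (∫ x, (m80Fv i x * conj (m80Fv j x)).re) -
        ∫ y, Ew.piecewise (fun _ ↦ 1 / (17 / 25 - (κ₂ : ℝ) - (lam : ℝ))) (fun _ ↦ 1 / (17 / 25 - (lam : ℝ))) y *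
          ((m80FF i - ∑ l, W i l • m80Fv l) y * conj ((m80FF j - ∑ l, W j l • m80Fv l) y)).re) := by
    intro α
    have h := hPSD α
    have e : ∀ i j, ∫ y, (rt i y * conj (rt j y)).re =
        ∫ y, Ew.piecewise (fun _ ↦ 1 / (17 / 25 - (κ₂ : ℝ) - (lam : ℝ))) (fun _ ↦ 1 / (17 / 25 - (lam : ℝ))) y *
          ((m80FF i - ∑ l, W i l • m80Fv l) y * conj ((m80FF j - ∑ l, W j l • m80Fv l) y)).re := by
      intro i j
      rw [hrt_cross]
      exact integral_congr_ae (Filter.Eventually.of_forall fun y ↦ by simp only [hr, hwform y])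
    simpa only [e] using h
  exact dt_weilOddGroundEnergy_ge_of_deflCert_w hc hc5 le_rfl weilCertDeflM80FR 272 m80F_Rodd.1 m80F_Rodd.2 hcert
    m80Fv m80FF (fun i x ↦ (m80F_mask i x).symm) (fun i y ↦ rfl) W hκ hlamR hy hPSD'

end Summit.RiemannHypothesis.RiemannHypothesis.Theorems.EvenWinsBeyondArch

end
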